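import Mathlib
import HarnessLib
import Literature.MathematicalPhysics.QuantumFieldTheory.ConstructiveQFTWave0
import Literature.MathematicalPhysics.QuantumFieldTheory.WilsonFlow
import Summits.Ventures.LatticeQCDFlow.Scaling.EntropyBudgetCoupling

/-!
# Direction/phase masks on the torus: which lattices admit them, and why a masked local update of the gauge field IS a coupling layer (the frozen-staple lemma)

HONEST FRAMING: exact (Metropolis-corrected) sampling algorithms for lattice gauge theory;
figures of merit are autocorrelation/cost numbers at stated couplings and volumes; no
continuum-physics claim.

Venture `LatticeQCDFlow` (cell pub-lqcd), topic `Exactness`; FANOUT row 14 (`eng-flowhmc`, engine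
`latflow.fthmc`, family B).  NEW WORK of the cell; nothing is cited as a fact; no number.  This is
the LATTICE-GEOMETRIC half of typing the engine's zero-parameter member (the leading-order
Wilson-flow map integrated by masked Euler sub-steps, `maps.u1_wilson_flow_lo` /
`maps.wilson_flow_lo`; Lüscher's ordering "(x,0) even, (x,0) odd, (x,1) even, …"): every sub-step
updates the links of ONE direction `μ` whose base point lies in ONE class `π` of a site colouring
`χ`, reading the plaquettes through each such link from the CURRENT field.  The engine feeds the
HMC force and accept step the plain sum of the per-link log-Jacobians, which is only right if the
sub-step is a COUPLING LAYER in the sense of row 31's `Theory2.coupleFun` (active links moved by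
single-link maps that depend on the FROZEN links only).  This file proves exactly that, on the
tree's torus `Site d L = (ℤ/L)^d`, `Edge d L`, `GaugeConfig d L G`, `plaquetteHolonomy`
(`Literature/…/ConstructiveQFTWave0`; `shift_sub_single` of `Literature/…/WilsonFlow`), for ANY
group `G` (so it serves `U(1)` now and `SU(N)`
later) — and says for which `L` such masks exist.

## Content (all statements about explicit expressions; no definition is introduced)

* Masks = PROPER COLOURINGS `χ : Site d L → X` of the nearest-neighbour torus graph
  (`χ (x + e_i) ≠ χ x`).  **`exists_phaseMask`** / **`exists_properMask`**: the engine's phase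
  masks `x ↦ (Σ_i x_i) mod w` exist as soon as `w ∣ L`, and are proper iff `w ≠ 1`
  (`ZMod.castHom`; the engine's `residual_geometry` width-`w` masks, "sides must be multiples of
  the width"); **`exists_parityMask`**: parity (`w = 2`) for even `L`.
  **`even_of_twoClassMask`**: conversely a proper colouring with only TWO classes forces `L` to
  be even as soon as `d ≥ 1` (walk `L` steps in one direction: the class alternates and must
  return) — the engine's refusal "parity-masked sub-steps need even lattice sides" is NECESSARY,
  not a convenience.
* **`links_eq_of_frozen_eq`** (any `G`): if two fields agree on every link outside the active
  class `{(x, μ) : χ x = π}`, then for every active base point `x` and every `ν ≠ μ` the six links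
  of the two staples of `(x, μ)` — `(x,ν), (x+ν̂,μ), (x+μ̂,ν)` and `(x−ν̂,μ), (x−ν̂+μ̂,ν), (x−ν̂,ν)` —
  agree (direction `ν ≠ μ`, or direction `μ` at a neighbouring site, whose colour differs);
  **`plaquetteHolonomy_eq_of_frozen_eq`** (any group): hence the two plaquettes through `(x, μ)`
  in the `(μ, ν)` plane are functions of the active link and the frozen links alone.
* **`coupleFun_maskedUpdate`** / **`coupleJac_maskedUpdate`** (any index type, any `G` with a
  `1`): the ABSTRACT PRINCIPLE — if a full-field update rule `u V i` of the active coordinates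
  depends only on `V i` and the frozen coordinates, then the masked update
  `V ↦ (i ↦ if p i then u V i else V i)` IS `Theory2.coupleFun p ψ` for the explicit single-link
  family `ψ a y g = u (frozen := y, link a := g, other active links := 1) a`, and likewise the
  product of per-link factors is `Theory2.coupleJac`.  The U(1) Wilson-flow sub-step is the
  instance treated in `Exactness/U1WilsonFlowLOSubstep.lean`.

NOT here: the analytic part (Jacobians, bijectivity: `U1WilsonFlowLOSubstep`); three-colourings of
odd tori (they exist — `exists_properMask` with `w = L` — but the engine does not use them);
anything about which mask or order is better.
-/

namespace Summit.Ventures.LatticeQCDFlow.Exactness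

open Literature.MathematicalPhysics.QuantumFieldTheory Summit.Ventures.LatticeQCDFlow.Theory2

/-! ## Which tori admit masks -/

section Masks

variable {d L : ℕ}

/-- **Phase masks.**  For `w ∣ L` the phase `x ↦ (Σ_i x_i) mod w` is well defined on the torus
`(ℤ/L)^d` and a unit shift in any direction advances it by one. -/
theorem exists_phaseMask (w : ℕ) (hwL : w ∣ L) :
    ∃ χ : Site d L → ZMod w, ∀ (x : Site d L) (i : Fin d), χ (x.shift i) = χ x + 1 := by
  refine ⟨fun x => ZMod.castHom hwL (ZMod w) (∑ j, x j), fun x i => ?_⟩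
  simp only [Site.shift, Pi.add_apply, Finset.sum_add_distrib, Finset.sum_pi_single',
    Finset.mem_univ, if_true, map_add, map_one]

/-- **Proper phase masks.**  For `w ∣ L`, `w ≠ 1`, the phase mask is a proper colouring of the
torus graph: neighbouring sites have different phases (the engine's width-`w` masks; `w = 2` is
parity). -/
theorem exists_properMask {w : ℕ} (hw : w ≠ 1) (hwL : w ∣ L) :
    ∃ χ : Site d L → ZMod w, ∀ (x : Site d L) (i : Fin d), χ (x.shift i) ≠ χ x := by
  haveI : Nontrivial (ZMod w) := ZMod.nontrivial_iff.mpr hw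
  obtain ⟨χ, hχ⟩ := exists_phaseMask (d := d) w hwL
  exact ⟨χ, fun x i h => one_ne_zero (add_eq_left.mp ((hχ x i).symm.trans h))⟩

/-- **Parity masks exist on even tori.** -/
theorem exists_parityMask (hL : Even L) :
    ∃ χ : Site d L → ZMod 2, ∀ (x : Site d L) (i : Fin d), χ (x.shift i) ≠ χ x :=
  exists_properMask (by decide) (even_iff_two_dvd.mp hL)

/-- **Two-class masks force even sides.**  If `d ≥ 1` and a proper colouring of the torus graph
takes only two values, then `L` is even: walking `L` steps in one direction returns to the start
while the class alternates at every step.  (The engine's refusal of odd sides for parity-masked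
sub-steps is therefore necessary.) -/
theorem even_of_twoClassMask (hd : 0 < d) {X : Type*} (χ : Site d L → X) {a b : X}
    (hab : ∀ x, χ x = a ∨ χ x = b) (hχ : ∀ (x : Site d L) (i : Fin d), χ (x.shift i) ≠ χ x) :
    Even L := by
  classical
  set i₀ : Fin d := ⟨0, hd⟩
  set f : ℕ → X := fun n => χ (Pi.single i₀ (n : ZMod L)) with hf
  -- one step flips the class
  have hstep : ∀ n, f (n + 1) = a ↔ ¬f n = a := by
    intro n
    have hne : f (n + 1) ≠ f n := by
      have hs : (Pi.single i₀ ((n + 1 : ℕ) : ZMod L) : Site d L) =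
          Site.shift (Pi.single i₀ (n : ZMod L) : Site d L) i₀ := by
        rw [Site.shift, ← Pi.single_add, Nat.cast_succ]
      simp only [hf, hs]
      exact hχ _ _
    constructor
    · exact fun h1 h0 => hne (h1.trans h0.symm)
    · intro h0
      rcases hab (Pi.single i₀ ((n + 1 : ℕ) : ZMod L)) with h | h
      · exact h
      · rcases hab (Pi.single i₀ (n : ZMod L)) with h' | h'
        · exact absurd h' h0
        · exact absurd (h.trans h'.symm) hne
  -- hence the class at step `n` is the class at step `0` iff `n` is even
  have hind : ∀ n, (f n = a ↔ (Even n ↔ f 0 = a)) := by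
    intro n
    induction n with
    | zero => simp
    | succ n ih => rw [hstep, ih, Nat.even_add_one, not_iff]
  -- after `L` steps we are back at the origin
  have hL : f L = f 0 := by simp [hf]
  have h := hind L
  rw [hL] at h
  by_cases h0 : f 0 = a
  · exact ((h.mp h0).mpr h0)
  · by_contra hodd
    exact h0 (h.mpr ⟨fun he => absurd he hodd, fun ha => absurd ha h0⟩)

end Masks

/-! ## The frozen-staple lemma -/

section Frozen

variable {d L : ℕ} {G X : Type*}

/-- **The six staple links of an active link are frozen.**  Colouring `χ` proper, active class =
direction `μ` with base point of colour `π`.  If `V` and `W` agree off the active class then, for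
an active base point `x` and `ν ≠ μ`, they agree on `(x,ν)`, `(x+ν̂,μ)`, `(x+μ̂,ν)`, `(x−ν̂,μ)`,
`(x−ν̂+μ̂,ν)`, `(x−ν̂,ν)`. -/
theorem links_eq_of_frozen_eq (χ : Site d L → X)
    (hχ : ∀ (x : Site d L) (i : Fin d), χ (x.shift i) ≠ χ x) {μ : Fin d} {π : X}
    {V W : GaugeConfig d L G} (hVW : ∀ e : Edge d L, ¬(e.2 = μ ∧ χ e.1 = π) → V e = W e)
    {x : Site d L} (hx : χ x = π) {ν : Fin d} (hν : ν ≠ μ) :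
    V (x, ν) = W (x, ν) ∧ V (x.shift ν, μ) = W (x.shift ν, μ) ∧
      V (x.shift μ, ν) = W (x.shift μ, ν) ∧
      V (x - Pi.single ν 1, μ) = W (x - Pi.single ν 1, μ) ∧
      V ((x - Pi.single ν 1).shift μ, ν) = W ((x - Pi.single ν 1).shift μ, ν) ∧
      V (x - Pi.single ν 1, ν) = W (x - Pi.single ν 1, ν) := by
  refine ⟨hVW _ fun h => hν h.1, hVW _ fun h => ?_, hVW _ fun h => hν h.1, hVW _ fun h => ?_,
    hVW _ fun h => hν h.1, hVW _ fun h => hν h.1⟩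
  · exact hχ x ν (h.2.trans hx.symm)
  · have h' := hχ (x - Pi.single ν 1) ν
    rw [shift_sub_single] at h'
    exact h' (hx.trans h.2.symm)

/-- **The plaquettes through an active link are functions of that link and the frozen links.**
(Any group.)  Under the hypotheses of `links_eq_of_frozen_eq`, if moreover `V (x,μ) = W (x,μ)`
then the plaquette at `x` and the plaquette at `x − ν̂` in the `(μ, ν)` plane agree. -/
theorem plaquetteHolonomy_eq_of_frozen_eq [Group G] (χ : Site d L → X)
    (hχ : ∀ (x : Site d L) (i : Fin d), χ (x.shift i) ≠ χ x) {μ : Fin d} {π : X}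
    {V W : GaugeConfig d L G} (hVW : ∀ e : Edge d L, ¬(e.2 = μ ∧ χ e.1 = π) → V e = W e)
    {x : Site d L} (hx : χ x = π) {ν : Fin d} (hν : ν ≠ μ) (ha : V (x, μ) = W (x, μ)) :
    plaquetteHolonomy V x μ ν = plaquetteHolonomy W x μ ν ∧
      plaquetteHolonomy V (x - Pi.single ν 1) μ ν =
        plaquetteHolonomy W (x - Pi.single ν 1) μ ν := by
  obtain ⟨h1, h2, h3, h4, h5, h6⟩ := links_eq_of_frozen_eq χ hχ hVW hx hν
  simp only [plaquetteHolonomy, shift_sub_single, ha, h1, h2, h3, h4, h5, h6, and_self]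

/-- An active link is not its own `ν`-neighbour (`ν ≠ μ` or not): under a proper colouring the
shifted base point has a different colour, so the edges differ.  (Used to separate the active
link from the other three links of its plaquettes.) -/
theorem shift_edge_ne (χ : Site d L → X) (hχ : ∀ (x : Site d L) (i : Fin d), χ (x.shift i) ≠ χ x)
    (x : Site d L) (μ ν : Fin d) :
    ((x.shift ν, μ) : Edge d L) ≠ (x, μ) ∧ ((x - Pi.single ν 1, μ) : Edge d L) ≠ (x, μ) := by
  refine ⟨fun h => hχ x ν (congrArg χ (Prod.mk.inj h).1), fun h => ?_⟩
  have h' := hχ (x - Pi.single ν 1) ν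
  rw [shift_sub_single] at h'
  exact h' (congrArg χ (Prod.mk.inj h).1).symm

end Frozen

/-! ## A masked local update is a coupling layer -/

section Principle

variable {ι : Type*} [DecidableEq ι] {p : ι → Prop} [DecidablePred p] {G : Type*} [One G]

/-- **A masked full-field update whose active values depend only on the link itself and the
frozen links IS a coupling layer**, with the explicit single-link family "freeze `y`, put `g` on
the link, anything (`1`) on the other active links, apply the rule". -/
theorem coupleFun_maskedUpdate (u : (ι → G) → ι → G)
    (hu : ∀ (V W : ι → G) (i : ι), p i → V i = W i → (∀ j, ¬p j → V j = W j) → u V i = u W i)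
    (V : ι → G) :
    coupleFun p (fun a y g =>
        u (fun j => if h : p j then (if j = (a : ι) then g else 1) else y ⟨j, h⟩) a) V =
      fun i => if p i then u V i else V i := by
  funext i
  by_cases hi : p i
  · rw [coupleFun_apply_of_pos _ _ hi, if_pos hi]
    exact hu _ _ i hi (by simp [hi]) fun j hj => by simp [hj]
  · rw [coupleFun_apply_of_neg _ _ hi, if_neg hi]

/-- The same for per-link factors: if `c V i` depends only on `V i` and the frozen links then the
coupling-layer Jacobian of the family `jac a y g = c (frozen := y, link a := g, others := 1) a` is
the plain product `∏_{active a} c V a` — the engine's running sum of per-link log-dets. -/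
theorem coupleJac_maskedUpdate [Fintype ι] (c : (ι → G) → ι → ℝ)
    (hc : ∀ (V W : ι → G) (i : ι), p i → V i = W i → (∀ j, ¬p j → V j = W j) → c V i = c W i)
    (V : ι → G) :
    coupleJac p (fun a y g =>
        c (fun j => if h : p j then (if j = (a : ι) then g else 1) else y ⟨j, h⟩) a) V =
      ∏ a : {i // p i}, c V a := by
  unfold coupleJac
  refine Finset.prod_congr rfl fun a _ => ?_
  exact hc _ _ a a.2 (by simp [a.2]) fun j hj => by simp [hj]

end Principle

end Summit.Ventures.LatticeQCDFlow.Exactness
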